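import Mathlib
import Literature.MathematicalPhysics.QuantumLattice.HubbardBandSectorCountingToolbox
import Summits.HubbardSuperconductivity.HubbardSuperconductivity.Theorems.KLProgrammeKLRegimeTwoPointLimitTwoShellBound
import HarnessLib

/-!
# Route `KLProgramme` — crux K3 `KLRegimeTwoPointLimit` (stmt-HubbardSuperconductivity-19937), support:
# the REFINED four-sector fibre count keyed to the transfer (DECOMP §2 C1 «Inputs»: the count BGM's
# Lemma 3.1 only gives in total `Cγ^{-h}|h|`), from Lemma E.1 / E.3

Cell `gate-hubbard-kl`, seat p1b; paper notes `HOME/prover-p1b/E1-NOTE.md` §2 (sectorised form) and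
`HOME/prover-p1b/U5-NOTE.md` §1(b). BGM 2006's isotropic four-sector count (Lemma 3.1 / App. A2, the
tree's `count_pairs_exists`: `#{(a, c)} ≤ K_p (J + 2 + log N)/w` on a grid of `N = 2π/w` angles) carries
the logarithm `log N ≍ |h|` — the particle–particle logarithm in counting form. This file proves the
FIBRE counts behind it WITHOUT any logarithm, keyed to the transfer of the fixed pair: for the
three-point level function `h(θ₁, θ₂, θ₃) = ε(p(θ₁) + p(θ₂) + p(θ₃)) - μ` of
`HubbardBandSectorCountingBounds` (the fourth momentum on the shell), fixed `θ₁, θ₂`, transfer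
`W = -(p(θ₁) + p(θ₂))`, grid `θ_c = w/2 + c w` (`c < N`, `N w = 2π`) and threshold `C_δ w`:

* `klfc_card_mul_le` — the discrete-to-continuous step: for an `Λ`-Lipschitz `G`, the number of grid
  points with `|G(θ_c)| ≤ δ`, times `w`, is at most the measure of the sublevel set `{|G| ≤ δ + Λw/2}`
  of one period (disjoint grid cells);
* `klfc_exists_fibre_count` — there are `w₀, v, K₁, K₂ > 0` depending only on the bundle `B`, the
  margin and `C_δ` such that for `0 < w ≤ w₀`:
  (i) COOPER-KEYED: if the cell representative of `W` has `0 < |W - 2πm|_∞ ≤ v` then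
      `#{c : |h(θ₁,θ₂,θ_c)| ≤ C_δ w} ≤ K₁/|W - 2πm|_∞` — uniformly `O(γ^{-t})` on the transfer scale `t`,
      no `|h|` (Lemma E.1's linear law, `kltb_exists_angular_bound` (i));
  (ii) away from the Cooper point: `≤ K₁ + K₂/√w` (the `√` law of Lemma E.3, clause (ii)).
  (The CAUSTIC-KEYED refinement `≤ K₁ + K₃/√r` for `W` at sup-distance `≥ r ≥ c₀w` from `2F_μ + 2πℤ²`,
  from `klan_exists_caustic_refined`, is the companion file `…ShellSectorFibreCountCaustic`.)
Summing (i) over the `a` with `|W(θ₁,θ_a)|_𝕋 ≍ γ^{-t}` (≍ `γ^{-t}/w` of them) gives `≍ K₁/w` per transfer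
scale `t` (`…ShellSectorClassCount`), and Lemma 3.1's `|h|` is the number of scales (U5-NOTE §1(b)).
Pure assembly over the seat's packaged angular bounds; no new geometry.
-/

noncomputable section

-- the tree's namespace `Summit.<Summit>.<Problem>.Theorems` repeats the summit name by design (D-0017)
set_option linter.dupNamespace false

open Real Set MeasureTheory
open scoped ENNReal
open Literature.MathematicalPhysics.QuantumLattice
open Literature.MathematicalPhysics.QuantumLattice.BandSectorCounting

namespace Summit.HubbardSuperconductivity.HubbardSuperconductivity.Theorems

/-! ### The discrete-to-continuous step -/

/-- **Grid points in a sublevel set.** Let `G : ℝ → ℝ` satisfy `|G x - G y| ≤ Λ|x - y|`, `0 < w`,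
`N w = 2π`. If the sublevel set `{θ ∈ [0, 2π] : |G θ| ≤ δ + Λ w/2}` has measure `≤ X` then the number
of grid angles `θ_c = w/2 + c w`, `c < N`, with `|G(θ_c)| ≤ δ` is at most `X/w`: the cells
`[c w, (c+1) w)` of such `c` are disjoint, lie in `[0, 2π]`, and on each `|G| ≤ δ + Λ w/2`. -/
theorem klfc_card_mul_le {G : ℝ → ℝ} {Λ w δ X : ℝ} {N : ℕ}
    (hLip : ∀ x y : ℝ, |G x - G y| ≤ Λ * |x - y|) (hΛ : 0 ≤ Λ) (hw : 0 < w)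
    (hN : (N : ℝ) * w = 2 * π) (hX : 0 ≤ X)
    (hvol : volume {θ ∈ Icc (0 : ℝ) (0 + 2 * π) | |G θ| ≤ δ + Λ * (w / 2)} ≤ ENNReal.ofReal X) :
    ((((Finset.range N).filter fun c : ℕ => |G (w / 2 + c * w)| ≤ δ).card : ℝ)) * w ≤ X := by
  classical
  set S := (Finset.range N).filter fun c : ℕ => |G (w / 2 + c * w)| ≤ δ with hS
  set I : ℕ → Set ℝ := fun c => Ico ((c : ℝ) * w) (((c : ℝ) + 1) * w) with hI
  have hsub : (⋃ c ∈ S, I c) ⊆ {θ ∈ Icc (0 : ℝ) (0 + 2 * π) | |G θ| ≤ δ + Λ * (w / 2)} := by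
    intro θ hθ
    rw [mem_iUnion₂] at hθ
    obtain ⟨c, hc, hθc⟩ := hθ
    rw [hS, Finset.mem_filter, Finset.mem_range] at hc
    obtain ⟨hcN, hGc⟩ := hc
    rw [hI] at hθc
    simp only [mem_Ico] at hθc
    have hc0 : (0 : ℝ) ≤ (c : ℝ) * w := by positivity
    have hc1 : ((c : ℝ) + 1) * w ≤ 2 * π := by
      have : (c : ℝ) + 1 ≤ N := by exact_mod_cast Nat.succ_le_of_lt hcN
      calc ((c : ℝ) + 1) * w ≤ (N : ℝ) * w := mul_le_mul_of_nonneg_right this hw.le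
        _ = 2 * π := hN
    refine ⟨⟨by linarith [hθc.1], by linarith [hθc.2]⟩, ?_⟩
    have hdist : |θ - (w / 2 + c * w)| ≤ w / 2 := by
      rw [abs_le]; constructor <;> linarith [hθc.1, hθc.2]
    have h1 := hLip θ (w / 2 + c * w)
    have h2 : Λ * |θ - (w / 2 + c * w)| ≤ Λ * (w / 2) := mul_le_mul_of_nonneg_left hdist hΛ
    have h3 : |G θ| ≤ |G (w / 2 + c * w)| + |G θ - G (w / 2 + c * w)| := by
      have := abs_add_le (G (w / 2 + c * w)) (G θ - G (w / 2 + c * w))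
      rwa [add_sub_cancel] at this
    linarith
  have hdisj : (S : Set ℕ).PairwiseDisjoint I := by
    intro c _ c' _ hne
    change Disjoint (I c) (I c')
    rw [hI]
    simp only
    rw [Set.Ico_disjoint_Ico]
    rcases lt_or_gt_of_ne hne with h | h
    · have h1 : ((c : ℝ) + 1) * w ≤ (c' : ℝ) * w := by
        have : (c : ℝ) + 1 ≤ c' := by exact_mod_cast Nat.succ_le_of_lt h
        exact mul_le_mul_of_nonneg_right this hw.le
      exact (min_le_left _ _).trans (h1.trans (le_max_right _ _))
    · have h1 : ((c' : ℝ) + 1) * w ≤ (c : ℝ) * w := by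
        have : (c' : ℝ) + 1 ≤ c := by exact_mod_cast Nat.succ_le_of_lt h
        exact mul_le_mul_of_nonneg_right this hw.le
      exact (min_le_right _ _).trans (h1.trans (le_max_left _ _))
  have hmeas : ∀ c ∈ S, MeasurableSet (I c) := fun c _ => measurableSet_Ico
  have hvolT : volume (⋃ c ∈ S, I c) = ENNReal.ofReal ((S.card : ℝ) * w) := by
    rw [measure_biUnion_finset hdisj hmeas]
    have hc : ∀ c ∈ S, volume (I c) = ENNReal.ofReal w := by
      intro c _
      rw [hI]
      simp only [Real.volume_Ico]
      congr 1; ring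
    rw [Finset.sum_congr rfl hc, Finset.sum_const, nsmul_eq_mul, ← ENNReal.ofReal_natCast,
      ← ENNReal.ofReal_mul (Nat.cast_nonneg _)]
  have hle := (measure_mono hsub).trans hvol
  rw [hvolT] at hle
  exact (ENNReal.ofReal_le_ofReal_iff hX).1 hle

/-! ### The fibre counts -/

section Main

variable {a b : ℝ} (B : BandBounds a b)
include B

/-- **The refined four-sector fibre count (Cooper-keyed, generic).** See the module docstring. For fixed `θ₁, θ₂` put `W = -(p_μ(θ₁) + p_μ(θ₂))` (so that `h(θ₁,θ₂,θ) = ε(p_μ(θ) - W) - μ`);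
the count is `#{c < N : |h(θ₁, θ₂, w/2 + c w)| ≤ C_δ w}` on the grid `N w = 2π`. -/
theorem klfc_exists_fibre_count {ηs Cδ : ℝ} (hηs : 0 < ηs) (hCδ : 0 < Cδ) :
    ∃ w₀ v K₁ K₂ : ℝ, 0 < w₀ ∧ 0 < v ∧ 0 < K₁ ∧ 0 < K₂ ∧
      ∀ (μ : ℝ), a ≤ μ - ηs → μ + ηs ≤ b → ∀ (θ₁ θ₂ w : ℝ) (N : ℕ), 0 < w → w ≤ w₀ →
        (N : ℝ) * w = 2 * π →
        (∀ m₀ m₁ : ℤ,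
          0 < max |-(bandX μ θ₁ + bandX μ θ₂) - m₀ * (2 * π)| |-(bandY μ θ₁ + bandY μ θ₂) - m₁ * (2 * π)| →
          max |-(bandX μ θ₁ + bandX μ θ₂) - m₀ * (2 * π)| |-(bandY μ θ₁ + bandY μ θ₂) - m₁ * (2 * π)| ≤ v →
          ((((Finset.range N).filter fun c : ℕ => |hfun μ θ₁ θ₂ (w / 2 + c * w)| ≤ Cδ * w).card : ℝ)) ≤
            K₁ / max |-(bandX μ θ₁ + bandX μ θ₂) - m₀ * (2 * π)| |-(bandY μ θ₁ + bandY μ θ₂) - m₁ * (2 * π)|) ∧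
        ((∀ m₀ m₁ : ℤ,
          v ≤ max |-(bandX μ θ₁ + bandX μ θ₂) - m₀ * (2 * π)| |-(bandY μ θ₁ + bandY μ θ₂) - m₁ * (2 * π)|) →
          ((((Finset.range N).filter fun c : ℕ => |hfun μ θ₁ θ₂ (w / 2 + c * w)| ≤ Cδ * w).card : ℝ)) ≤
            K₁ + K₂ / Real.sqrt w) := by
  have hπ := Real.pi_pos
  have hs := B.smax_pos
  obtain ⟨δ₀, v, C₁, C₂, hδ₀, hv0, hC₁, hC₂, hang⟩ := kltb_exists_angular_bound B hηs
  -- the effective threshold `δ' = (C_δ + 2 s_max) w`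
  obtain ⟨κ, hκ⟩ : ∃ x : ℝ, x = Cδ + 2 * B.smax := ⟨_, rfl⟩
  have hκ0 : 0 < κ := by rw [hκ]; positivity
  have hκ' := hκ0.ne'
  obtain ⟨w₀, hw₀⟩ : ∃ x : ℝ, x = δ₀ / κ := ⟨_, rfl⟩
  have hw₀0 : 0 < w₀ := by rw [hw₀]; positivity
  have hw₀1 : w₀ ≤ δ₀ / κ := by rw [hw₀]
  refine ⟨w₀, v, C₁ * κ, C₂ * Real.sqrt κ, hw₀0, hv0, by positivity, by positivity, ?_⟩
  intro μ hlo hhi θ₁ θ₂ w N hw hww₀ hN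
  have hμ : μ ∈ Icc a b := ⟨by linarith, by linarith⟩
  obtain ⟨h1, h2⟩ := B.level hμ
  -- the transfer and the level function along the fibre
  set W₁ := -(bandX μ θ₁ + bandX μ θ₂) with hW₁
  set W₂ := -(bandY μ θ₁ + bandY μ θ₂) with hW₂
  set G : ℝ → ℝ := fun θ => eps2 (bandX μ θ - W₁) (bandY μ θ - W₂) - μ with hG
  have hGh : ∀ θ, hfun μ θ₁ θ₂ θ = G θ := by
    intro θ
    simp only [hG, hfun, SX, SY, hW₁, hW₂]
    ring_nf
  have hGd : ∀ t, HasDerivAt G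
      (2 * (Real.sin (bandX μ t - W₁) * bandVX μ t + Real.sin (bandY μ t - W₂) * bandVY μ t)) t :=
    fun t => (klst_hasDerivAt_transLevel h1 h2 W₁ W₂ t).sub_const μ
  have hbound : ∀ t, |2 * (Real.sin (bandX μ t - W₁) * bandVX μ t +
      Real.sin (bandY μ t - W₂) * bandVY μ t)| ≤ 4 * B.smax := by
    intro t
    have hsX := abs_sin_le_one (bandX μ t - W₁)
    have hsY := abs_sin_le_one (bandY μ t - W₂)
    have hVX := B.abs_VX_le μ hμ t
    have hVY := B.abs_VY_le μ hμ t
    rw [abs_mul, abs_two]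
    have h3 : |Real.sin (bandX μ t - W₁) * bandVX μ t + Real.sin (bandY μ t - W₂) * bandVY μ t| ≤
        |Real.sin (bandX μ t - W₁)| * |bandVX μ t| + |Real.sin (bandY μ t - W₂)| * |bandVY μ t| := by
      have := abs_add_le (Real.sin (bandX μ t - W₁) * bandVX μ t) (Real.sin (bandY μ t - W₂) * bandVY μ t)
      rwa [abs_mul, abs_mul] at this
    have h4 : |Real.sin (bandX μ t - W₁)| * |bandVX μ t| ≤ 1 * B.smax :=
      mul_le_mul hsX hVX (abs_nonneg _) zero_le_one
    have h5 : |Real.sin (bandY μ t - W₂)| * |bandVY μ t| ≤ 1 * B.smax :=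
      mul_le_mul hsY hVY (abs_nonneg _) zero_le_one
    linarith
  have hLip : ∀ x y : ℝ, |G x - G y| ≤ 4 * B.smax * |x - y| := by
    intro x y
    have h := Convex.norm_image_sub_le_of_norm_deriv_le (f := G) (s := univ) (C := 4 * B.smax)
      (fun t _ => (hGd t).differentiableAt) (fun t _ => by rw [(hGd t).deriv]; exact hbound t)
      convex_univ (mem_univ y) (mem_univ x)
    simpa [Real.norm_eq_abs] using h
  -- the count as a function of the angular sublevel measure
  have hS : ((Finset.range N).filter fun c : ℕ => |hfun μ θ₁ θ₂ (w / 2 + c * w)| ≤ Cδ * w) =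
      ((Finset.range N).filter fun c : ℕ => |G (w / 2 + c * w)| ≤ Cδ * w) := by
    apply Finset.filter_congr
    intro c _
    rw [hGh]
  have hδ' : Cδ * w + 4 * B.smax * (w / 2) = κ * w := by rw [hκ]; ring
  have hκw0 : 0 < κ * w := by positivity
  have hκwδ₀ : κ * w ≤ δ₀ := by
    have := hww₀.trans hw₀1
    rw [le_div_iff₀ hκ0] at this; linarith
  obtain ⟨hA1, hA2, -⟩ := hang μ hlo hhi (κ * w) W₁ W₂ 0 hκw0 hκwδ₀
  have step : ∀ X : ℝ, 0 ≤ X →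
      volume {θ ∈ Icc (0 : ℝ) (0 + 2 * π) | |eps2 (bandX μ θ - W₁) (bandY μ θ - W₂) - μ| ≤ κ * w} ≤
        ENNReal.ofReal X →
      ((((Finset.range N).filter fun c : ℕ => |hfun μ θ₁ θ₂ (w / 2 + c * w)| ≤ Cδ * w).card : ℝ))
        * w ≤ X := by
    intro X hX hvol
    rw [hS]
    refine klfc_card_mul_le hLip (by positivity) hw hN hX ?_
    rw [hδ']
    exact hvol
  refine ⟨fun m₀ m₁ hpos hle => ?_, fun hfar => ?_⟩
  · -- (i) Cooper-keyed: pass to the representative `W - 2πm`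
    have hA := hang μ hlo hhi (κ * w) (W₁ - m₀ * (2 * π)) (W₂ - m₁ * (2 * π)) 0 hκw0 hκwδ₀
    obtain ⟨hB1, -, -⟩ := hA
    have hvol := hB1 hpos hle
    rw [klan_sublevel_eq_of_sub_int_mul μ W₁ W₂ (κ * w) (Icc (0 : ℝ) (0 + 2 * π)) m₀ m₁] at hvol
    set ρ := max |W₁ - m₀ * (2 * π)| |W₂ - m₁ * (2 * π)| with hρ
    have hb := step (C₁ * (κ * w) / ρ) (by positivity) hvol
    have e : C₁ * (κ * w) / ρ = C₁ * κ / ρ * w := by ring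
    rw [e] at hb
    exact le_of_mul_le_mul_right hb hw
  · -- (ii) away from the Cooper point: `C₁ κ w + C₂ √(κ w)`
    have hvol := hA2 hfar
    have hb := step (C₁ * (κ * w) + C₂ * Real.sqrt (κ * w)) (by positivity) hvol
    have e1 : Real.sqrt (κ * w) = Real.sqrt κ * Real.sqrt w := Real.sqrt_mul hκ0.le w
    have hsw : 0 < Real.sqrt w := Real.sqrt_pos.2 hw
    have e2 : C₂ * Real.sqrt κ / Real.sqrt w * w = C₂ * (Real.sqrt κ * Real.sqrt w) := by
      have : Real.sqrt w * Real.sqrt w = w := Real.mul_self_sqrt hw.le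
      field_simp
      nlinarith [this]
    have h3 : C₁ * (κ * w) = C₁ * κ * w := by ring
    have key : ((((Finset.range N).filter fun c : ℕ => |hfun μ θ₁ θ₂ (w / 2 + c * w)| ≤ Cδ * w).card
        : ℝ)) * w ≤ (C₁ * κ + C₂ * Real.sqrt κ / Real.sqrt w) * w := by
      rw [add_mul, e2, ← e1]; linarith
    exact le_of_mul_le_mul_right key hw
end Main

end Summit.HubbardSuperconductivity.HubbardSuperconductivity.Theorems

end
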